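import Summits.QuantumFields.BalabanUV.Beta.FP.TowerK2bDefectSplit

/-!
# `BalabanUV.Beta.FP.TowerK2bDefectRooted` — binder row D1 ∕ (C1) OWNER «beta-an2», PART 36: **THE WARD DEFECT IS THE TWIST OF THE BRICK TABLE BY THE
# GAUGE GENERATORS ROOTED AT THE BRICKS — and a SINGLE rooted fine generator reproduces it only up to an explicit OVERLAP word**
# (the row's answer A-4 [AN2-G72-A4] to Q-FP-48-1, «the only action producing `Def` is conjugation RELATIVE TO THE BRICK ROOTS», made a kernel identity
# with its hypothesis displayed; over the letters of road «FP» `TowerK2bStoreyBridge` §0 ∕ `TowerK2bDefectSplit` VERBATIM)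

WHY.  Road `TowerK2bDefectSplit.defect_eq_commutator_add_root` (p621072) splits the top storey of the END wrapper's Ward defect as `w•[E_λ, B] + (root word)
+ lower`, `E_λ = diagonal (λ ∘ pr)` the FINEST generator, `B = Σ h b₁ b₂ • L b₁ ⊗ L b₂` the brick-weighted transport table; by value (Engine C K2L-SPLIT,
be58ae2dd241cb1b) the two words are of equal size and opposite sign and `Def` is their 13–64 % remainder — the INTRA-brick word.  THIS FILE says what that
word IS as an action, with no hypothesis: §1 **`defect_eq_rooted_twist`** — `Def_top = w • Σ_{b₁b₂} h b₁ b₂ • (G_{b₁}·(L b₁ ⊗ L b₂) − (L b₁ ⊗ L b₂)·G_{b₂})`,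
`G_b := diagonal (λ ∘ pr − λ (rt b))` the fine gauge generator ROOTED AT THE BRICK `b` (each leg is turned by the gauge function measured from ITS OWN root;
equivalently the D-word form `Σ h • (D b₁ ⊗ L b₂ − L b₁ ⊗ D b₂)`, `D b x = (λ (pr x) − λ (rt b))·L b x`, **`defect_eq_Dword`** — the K-bridge's header formula
as a theorem); §2 for ANY root field `c : ι → σ` (a candidate assignment of ONE root to every fine index — e.g. the root of the block containing it) and the
single rooted generator `Ĝ_c := diagonal (λ ∘ pr − λ ∘ c)`: **`rootedTwist_eq_commutator_add_overlap`** — the rooted twist `= [Ĝ_c, B] + Σ h b₁ b₂ •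
(O_{c,b₁} ⊗ L b₂ − L b₁ ⊗ O_{c,b₂})`, `O_{c,b} x := (λ (c x) − λ (rt b))·L b x` the OVERLAP word (the leg of brick `b` read at fine indices whose assigned root
is NOT `b`'s root), hence **`defect_eq_commutator_rooted_add_overlap`** (hypothesis-free; at `λ ∘ c = 0` it is DefectSplit's split, at `c = pr` it is the
D-word form — the two located words of R-FP-48 are the two ends of one interpolation); §3 **`defect_eq_commutator_rooted_of_consistent`** — IF the legs are
ROOT-CONSISTENT for `c` (`(λ (c x) − λ (rt b))·L b x = 0` for all `b x`: every leg lives on fine indices assigned its own root) THEN `Def_top = w•[Ĝ_c, B] +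
lower`: ONE inner fine generator — A-4's `E_λ − Σ_b λ(rt b)•Π_b` — produces the defect, and ONLY under that displayed hypothesis does the row claim it.
WHAT THIS LOCATES (zero weight, for the law owner and the road): a storeywise door realised as a CONGRUENCE OF THE FINE FIELD by a modified diagonal generator
exists iff the overlap word's symmetrised `Ŝ`-contraction vanishes at the read-outs; whether the window bonds' legs (`compLinKer` ∕ `symLinKerAt` columns of
bonds with distinct base blocks) are root-consistent for the block-root field is a BY-VALUE question (Engine C, one word, if the road or the REFEREE wants it),
not claimed here either way; if they are not, the rooted action is LEG-wise (it turns the level-`m` variables, i.e. it lives in the GRADED system), not a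
fine-field congruence.  [folklore] `Matrix`∕`Finset` algebra BY NAME over abstract finite index types; no `def`, no `def … : Prop`, nothing cited, 0 sorry;
nothing of Bałaban's asserted, valued or discharged; (J-R₂″) NOT claimed either way; 0∕4 row-D1 binders (hW ∕ hR ∕ D1Tel ∕ D1Rep); NOT (C1), NOT (T-ID),
NOT D1, NEVER «G-an2-4 closed», NOT BetaPertH, NOT continuum, NOT Clay.
HONEST DEPENDENCY (page 1, mandatory): continuum YM on T⁴ ⇐ BetaPertH ∧ nine spine estimates (0/9 proved); BetaPertH ⇐ (D1) ∧ (D4) ∧ CAP+tail;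
G-an2-4 gates asym, D1 and NE2/3/4.  HONEST FRAMING (cell contract, verbatim): «discharging `BetaPertH` makes Bałaban's UV stability UNCONDITIONAL —
a real constructive-QFT result; it is NOT the continuum limit and NOT the Clay problem.»  ABSOLUTE RULE (cell charter, verbatim): «No internally-minted
statement may enter as a cited fact. Every hypothesis is either kernel-proved in this package or a verbatim quotation of a PUBLISHED theorem with page
reference. The manuscript(s) under audit are NOT citable for their own disputed steps — they are the thing under adjudication; programme-internal
(2001/route/tribunal) claims are never citable.»  Row D1 ∕ (C1) OWNER, b2b-balaban-beta-an2 gen 73, 2026-08-28 (v1.1: `overlap_eq_root_of_unrooted` named and worded with the sign it proves —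
chair leaf-03 g61 DOCFIX-2 [D1LEAF03-G61-XV11]).  No existing file touched.
-/

noncomputable section

open scoped BigOperators

namespace Summit.QuantumFields.BalabanUV.Beta.FP.TowerK2bDefectRooted

open Finset Matrix
open Summit.QuantumFields.BalabanUV.Beta.FP.TowerK2bStoreyBridge (diagonal_mul_vecMulVec vecMulVec_mul_diagonal sum_smul_vecMulVec_indicator_left
  sum_smul_vecMulVec_indicator_right sum_smul_top_add_low)
open Summit.QuantumFields.BalabanUV.Beta.FP.TowerK2bDefectSplit (commutator_vecMulVec_sum defect_eq_commutator_add_root)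

variable {ι σ τ : Type*} [Fintype ι] [DecidableEq ι] [Fintype σ] [DecidableEq σ] [Fintype τ]

/-! ## §1 The defect is the twist of the brick table by the brick-ROOTED generators (no hypothesis) -/

/-- [folklore] **`defect_eq_rooted_twist` — THE TOP STOREY OF THE WARD DEFECT IS THE ROOTED TWIST OF THE BRICK TABLE**: with `G_b := diagonal (λ ∘ pr − λ (rt b))`
the fine gauge generator rooted at the brick `b`, `Σ_s λ s • Rs s = w • Σ_{b₁b₂} h b₁ b₂ • (G_{b₁}·(L b₁ ⊗ L b₂) − (L b₁ ⊗ L b₂)·G_{b₂}) + Σ_b ℓ b • Σ_s λ s • Rl s b`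
(the letters of `TowerK2bDefectSplit.defect_eq_commutator_add_root` VERBATIM on the left). -/
theorem defect_eq_rooted_twist (pr : ι → σ) (lam : σ → ℝ) (h : τ → τ → ℝ) (L : τ → ι → ℝ) (rt : τ → σ) (ℓ : τ → ℝ)
    (Rl : σ → τ → Matrix ι ι ℝ) (w : ℝ) :
    ∑ s, lam s • (w • ∑ b₁, ∑ b₂, h b₁ b₂ • (Matrix.vecMulVec (fun x => ((if pr x = s then (1 : ℝ) else 0) - (if rt b₁ = s then (1 : ℝ) else 0)) * L b₁ x) (L b₂)
              - Matrix.vecMulVec (L b₁) (fun z => ((if pr z = s then (1 : ℝ) else 0) - (if rt b₂ = s then (1 : ℝ) else 0)) * L b₂ z))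
            + ∑ b, ℓ b • Rl s b)
      = w • ∑ b₁, ∑ b₂, h b₁ b₂ • (Matrix.diagonal (fun x => lam (pr x) - lam (rt b₁)) * Matrix.vecMulVec (L b₁) (L b₂)
              - Matrix.vecMulVec (L b₁) (L b₂) * Matrix.diagonal (fun z => lam (pr z) - lam (rt b₂)))
        + ∑ b, ℓ b • ∑ s, lam s • Rl s b := by
  rw [defect_eq_commutator_add_root, commutator_vecMulVec_sum, ← smul_add]
  congr 2
  rw [← Finset.sum_add_distrib]
  refine Finset.sum_congr rfl fun b₁ _ => ?_
  rw [← Finset.sum_add_distrib]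
  refine Finset.sum_congr rfl fun b₂ _ => ?_
  rw [diagonal_mul_vecMulVec, vecMulVec_mul_diagonal]
  ext x z
  simp only [Matrix.add_apply, Matrix.sub_apply, Matrix.smul_apply, Matrix.vecMulVec_apply, smul_eq_mul]
  ring

/-- [folklore] **`defect_eq_Dword` — THE D-WORD FORM** (the K-bridge `TowerK2bStoreyBridgeTwo`'s header formula as a theorem): with `D b x := (λ (pr x) − λ (rt b))·L b x`
the transport-variation word of the leg `b`, `Σ_s λ s • Rs s = w • Σ_{b₁b₂} h b₁ b₂ • (D b₁ ⊗ L b₂ − L b₁ ⊗ D b₂) + Σ_b ℓ b • Σ_s λ s • Rl s b`. -/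
theorem defect_eq_Dword (pr : ι → σ) (lam : σ → ℝ) (h : τ → τ → ℝ) (L : τ → ι → ℝ) (rt : τ → σ) (ℓ : τ → ℝ)
    (Rl : σ → τ → Matrix ι ι ℝ) (w : ℝ) :
    ∑ s, lam s • (w • ∑ b₁, ∑ b₂, h b₁ b₂ • (Matrix.vecMulVec (fun x => ((if pr x = s then (1 : ℝ) else 0) - (if rt b₁ = s then (1 : ℝ) else 0)) * L b₁ x) (L b₂)
              - Matrix.vecMulVec (L b₁) (fun z => ((if pr z = s then (1 : ℝ) else 0) - (if rt b₂ = s then (1 : ℝ) else 0)) * L b₂ z))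
            + ∑ b, ℓ b • Rl s b)
      = w • ∑ b₁, ∑ b₂, h b₁ b₂ • (Matrix.vecMulVec (fun x => (lam (pr x) - lam (rt b₁)) * L b₁ x) (L b₂)
              - Matrix.vecMulVec (L b₁) (fun z => (lam (pr z) - lam (rt b₂)) * L b₂ z))
        + ∑ b, ℓ b • ∑ s, lam s • Rl s b := by
  rw [defect_eq_rooted_twist]
  simp only [diagonal_mul_vecMulVec, vecMulVec_mul_diagonal, mul_comm (L _ _) _]

/-! ## §2 One candidate rooted fine generator and the OVERLAP word it misses (no hypothesis) -/

omit [Fintype σ] [DecidableEq σ] in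
/-- [folklore] **`rootedTwist_eq_commutator_add_overlap`** — for ANY root field `c : ι → σ` (one root assigned to every fine index) and the single rooted generator
`Ĝ_c := diagonal (λ ∘ pr − λ ∘ c)`: the rooted twist of the brick table is the plain commutator with `Ĝ_c` PLUS the overlap word
`Σ h b₁ b₂ • (O_{b₁} ⊗ L b₂ − L b₁ ⊗ O_{b₂})`, `O_b x := (λ (c x) − λ (rt b))·L b x` (the leg of `b` on the fine indices NOT assigned `b`'s root). -/
theorem rootedTwist_eq_commutator_add_overlap (pr c : ι → σ) (lam : σ → ℝ) (h : τ → τ → ℝ) (L : τ → ι → ℝ) (rt : τ → σ) :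
    ∑ b₁, ∑ b₂, h b₁ b₂ • (Matrix.diagonal (fun x => lam (pr x) - lam (rt b₁)) * Matrix.vecMulVec (L b₁) (L b₂)
        - Matrix.vecMulVec (L b₁) (L b₂) * Matrix.diagonal (fun z => lam (pr z) - lam (rt b₂)))
      = (Matrix.diagonal (fun x => lam (pr x) - lam (c x)) * (∑ b₁, ∑ b₂, h b₁ b₂ • Matrix.vecMulVec (L b₁) (L b₂))
          - (∑ b₁, ∑ b₂, h b₁ b₂ • Matrix.vecMulVec (L b₁) (L b₂)) * Matrix.diagonal (fun x => lam (pr x) - lam (c x)))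
        + ∑ b₁, ∑ b₂, h b₁ b₂ • (Matrix.vecMulVec (fun x => (lam (c x) - lam (rt b₁)) * L b₁ x) (L b₂)
            - Matrix.vecMulVec (L b₁) (fun z => (lam (c z) - lam (rt b₂)) * L b₂ z)) := by
  rw [commutator_vecMulVec_sum]
  ext x z
  simp only [Matrix.add_apply, Matrix.sub_apply, Matrix.smul_apply, Matrix.sum_apply, Matrix.vecMulVec_apply, diagonal_mul_vecMulVec,
    vecMulVec_mul_diagonal, smul_eq_mul, ← Finset.sum_add_distrib]
  refine Finset.sum_congr rfl fun b₁ _ => Finset.sum_congr rfl fun b₂ _ => ?_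
  ring

/-- [folklore] **`defect_eq_commutator_rooted_add_overlap` — THE DEFECT AGAINST ONE ROOTED FINE GENERATOR (hypothesis-free)**: for any root field `c`,
`Σ_s λ s • Rs s = w • [Ĝ_c, B] + w • (overlap word of c) + Σ_b ℓ b • Σ_s λ s • Rl s b`.  At `λ ∘ c = 0` this is DefectSplit's `w•[E_λ,B] + root word + lower`
(the overlap word is then EXACTLY the road's root word, `overlap_eq_root_of_unrooted`); at `c = pr` the commutator vanishes and the overlap word is the whole D-word
(`defect_eq_Dword`). -/
theorem defect_eq_commutator_rooted_add_overlap (pr c : ι → σ) (lam : σ → ℝ) (h : τ → τ → ℝ) (L : τ → ι → ℝ) (rt : τ → σ) (ℓ : τ → ℝ)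
    (Rl : σ → τ → Matrix ι ι ℝ) (w : ℝ) :
    ∑ s, lam s • (w • ∑ b₁, ∑ b₂, h b₁ b₂ • (Matrix.vecMulVec (fun x => ((if pr x = s then (1 : ℝ) else 0) - (if rt b₁ = s then (1 : ℝ) else 0)) * L b₁ x) (L b₂)
              - Matrix.vecMulVec (L b₁) (fun z => ((if pr z = s then (1 : ℝ) else 0) - (if rt b₂ = s then (1 : ℝ) else 0)) * L b₂ z))
            + ∑ b, ℓ b • Rl s b)
      = w • (Matrix.diagonal (fun x => lam (pr x) - lam (c x)) * (∑ b₁, ∑ b₂, h b₁ b₂ • Matrix.vecMulVec (L b₁) (L b₂))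
              - (∑ b₁, ∑ b₂, h b₁ b₂ • Matrix.vecMulVec (L b₁) (L b₂)) * Matrix.diagonal (fun x => lam (pr x) - lam (c x)))
        + w • ∑ b₁, ∑ b₂, h b₁ b₂ • (Matrix.vecMulVec (fun x => (lam (c x) - lam (rt b₁)) * L b₁ x) (L b₂)
            - Matrix.vecMulVec (L b₁) (fun z => (lam (c z) - lam (rt b₂)) * L b₂ z))
        + ∑ b, ℓ b • ∑ s, lam s • Rl s b := by
  rw [defect_eq_rooted_twist, rootedTwist_eq_commutator_add_overlap pr c, smul_add]

/-! ## §3 Root-consistent legs: ONE inner rooted generator produces the defect (the hypothesis DISPLAYED) -/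

omit [Fintype ι] [DecidableEq ι] [Fintype σ] [DecidableEq σ] in
/-- [folklore] the overlap word of a root field `c` VANISHES when every leg lives on fine indices assigned its own root
(`(λ (c x) − λ (rt b))·L b x = 0` for all `b x`). -/
theorem overlap_eq_zero_of_consistent (c : ι → σ) (lam : σ → ℝ) (h : τ → τ → ℝ) (L : τ → ι → ℝ) (rt : τ → σ)
    (hcons : ∀ b x, (lam (c x) - lam (rt b)) * L b x = 0) :
    ∑ b₁, ∑ b₂, h b₁ b₂ • (Matrix.vecMulVec (fun x => (lam (c x) - lam (rt b₁)) * L b₁ x) (L b₂)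
        - Matrix.vecMulVec (L b₁) (fun z => (lam (c z) - lam (rt b₂)) * L b₂ z)) = 0 := by
  refine Finset.sum_eq_zero fun b₁ _ => Finset.sum_eq_zero fun b₂ _ => ?_
  ext x z
  simp only [Matrix.smul_apply, Matrix.sub_apply, Matrix.vecMulVec_apply, Matrix.zero_apply, hcons, zero_mul, mul_zero, sub_zero, smul_zero]

/-- [folklore] **`defect_eq_commutator_rooted_of_consistent` — A-4's WORD WITH ITS HYPOTHESIS**: IF the legs are root-consistent for the root field `c`, THEN the
top storey of the Ward defect is the plain commutator of the brick table with the ONE rooted fine generator `Ĝ_c = diagonal (λ ∘ pr − λ ∘ c)` (= `E_λ − Σ_b λ(rt b)•Π_b`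
when `c` is the block-root field of a brick partition): `Σ_s λ s • Rs s = w • [Ĝ_c, B] + Σ_b ℓ b • Σ_s λ s • Rl s b`.  Only under this displayed hypothesis is the
rooted action an inner CONGRUENCE of the fine field; the row does not claim the hypothesis for the wrapper's window-bond legs. -/
theorem defect_eq_commutator_rooted_of_consistent (pr c : ι → σ) (lam : σ → ℝ) (h : τ → τ → ℝ) (L : τ → ι → ℝ) (rt : τ → σ) (ℓ : τ → ℝ)
    (Rl : σ → τ → Matrix ι ι ℝ) (w : ℝ) (hcons : ∀ b x, (lam (c x) - lam (rt b)) * L b x = 0) :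
    ∑ s, lam s • (w • ∑ b₁, ∑ b₂, h b₁ b₂ • (Matrix.vecMulVec (fun x => ((if pr x = s then (1 : ℝ) else 0) - (if rt b₁ = s then (1 : ℝ) else 0)) * L b₁ x) (L b₂)
              - Matrix.vecMulVec (L b₁) (fun z => ((if pr z = s then (1 : ℝ) else 0) - (if rt b₂ = s then (1 : ℝ) else 0)) * L b₂ z))
            + ∑ b, ℓ b • Rl s b)
      = w • (Matrix.diagonal (fun x => lam (pr x) - lam (c x)) * (∑ b₁, ∑ b₂, h b₁ b₂ • Matrix.vecMulVec (L b₁) (L b₂))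
              - (∑ b₁, ∑ b₂, h b₁ b₂ • Matrix.vecMulVec (L b₁) (L b₂)) * Matrix.diagonal (fun x => lam (pr x) - lam (c x)))
        + ∑ b, ℓ b • ∑ s, lam s • Rl s b := by
  rw [defect_eq_commutator_rooted_add_overlap pr c, overlap_eq_zero_of_consistent c lam h L rt hcons, smul_zero, add_zero]

omit [Fintype ι] [DecidableEq ι] [Fintype σ] [DecidableEq σ] in
/-- [folklore] **`overlap_eq_root_of_unrooted`** — the UNROOTED end of the interpolation: for a root field on which the gauge function vanishes
(`λ (c x) = 0` for all `x`) the overlap word IS the road's root word `Σ ((λ(rt b₂) − λ(rt b₁))·h b₁ b₂) • L b₁ ⊗ L b₂` (orientation and sign as in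
`TowerK2bDefectSplit.defect_eq_commutator_add_root`) — and `Ĝ_c = E_λ`, so DefectSplit is recovered term by term. -/
theorem overlap_eq_root_of_unrooted (c : ι → σ) (lam : σ → ℝ) (h : τ → τ → ℝ) (L : τ → ι → ℝ) (rt : τ → σ) (hc : ∀ x, lam (c x) = 0) :
    ∑ b₁, ∑ b₂, h b₁ b₂ • (Matrix.vecMulVec (fun x => (lam (c x) - lam (rt b₁)) * L b₁ x) (L b₂)
        - Matrix.vecMulVec (L b₁) (fun z => (lam (c z) - lam (rt b₂)) * L b₂ z))
      = ∑ b₁, ∑ b₂, ((lam (rt b₂) - lam (rt b₁)) * h b₁ b₂) • Matrix.vecMulVec (L b₁) (L b₂) := by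
  refine Finset.sum_congr rfl fun b₁ _ => Finset.sum_congr rfl fun b₂ _ => ?_
  ext x z
  simp only [Matrix.smul_apply, Matrix.sub_apply, Matrix.vecMulVec_apply, smul_eq_mul, hc, zero_sub]
  ring

end Summit.QuantumFields.BalabanUV.Beta.FP.TowerK2bDefectRooted

end
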